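import Summits.QuantumFields.YangMills.Theorems.UnitScaleTiltProp7SectET3ClassTransferZd
import Literature.MathematicalPhysics.QuantumFieldTheory.Balaban1983to89.B8Prop6PrintedZdCubPGammaL3
import HarnessLib

/-!
# Route `UnitScaleTilt`, crux «MinimiserStabilityRegPr» (stmt-QuantumFields-19200, EX) ∕ deciding crux 20520 — item I-07 of `pub/ym-inputs/INPUT-LIST.md`
# (class transfer (3.35)–(3.36)), L-FLOOR LEDGER (★★OWNER ym3-torus-plan g26 RULING №20; LF-1's EX reach, ym-inputs-p09 LF-3a): **[4] (3.35)–(3.36) ON ONE CLASS CUBE OF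
# THE ALL-TORUS `ℤᵈ` MEMBER FROM [B8] PROPOSITION 6 — FOR EVERY ODD `L ≥ 3`** (the `L ≥ 3` twin of ✓ `Prop7SectET3ClassTransferZd.reg336Cube_zd_of_inAk (hL5 : 5 ≤ L)`)

Cell `ym-inputs` (desk ym-inputs-plan-1, seat ym-inputs-p06 g2), HUMAN RULING D-0037: YM₃ on T³ is ladder rung R3 — NOT the Clay problem.  Count-neutral helper
(`--supports stmt-QuantumFields-20520 --as helper`); THEOREMS ONLY (0 `def`, 0 `sorry`); nothing of [Balaban1985RegularSpaces] ∕ [Balaban1985BackgroundPropagators] is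
asserted; ✓ `Prop7SectET3ClassTransferZd` (seat g1, p618952) is CONSUMED BY NAME (its per-cube bridge `reg336Cube_of_gaugedBoundB8`, `2 ≤ L`), not modified.

WHY.  g1's ℤᵈ supplier of the T³ class-transfer row carried `hL5 : 5 ≤ L` for ONE reason: it read Proposition 6 through
`B8Prop6PrintedZdCubPGamma.prop6Printed_zdCubP_γ_holds (hL5)`, floored by dag-n05-c's transplant of the named flat fact (1.59)∣_{U₀=1} to lit-balaban's L0 torus
reading.  `B8Prop6PrintedZdCubPGammaL3.prop6Printed_zdCubP_γ_holds_L3` (this seat, Literature side: the transplant re-pointed at the V1L3 lineage's floor-free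
[B6] Prop. 2.6 producer) gives the same sentence for every odd `L ≥ 3`; the proof below is g1's §3 LETTER FOR LETTER with that supplier.
★★ `reg336Cube_zd_of_inAk_L3 (hd2 : 2 ≤ d) (hL3 : 3 ≤ L) (hodd : Odd L)` — statement VERBATIM that of `reg336Cube_zd_of_inAk` with `hL5` ↦ `hL3`.

WHAT STAYS FLOORED (honest).  The T³ knit ✓ `Prop7SectET3ClassTransfer.reg335_reg336_T3_of_regPr (hℓ4 : 4 ≤ ℓ)` names ★w3-20520's member of record
`Prop7SectET3Members.memberIdx ℓ hL (hℓ : 4 ≤ ℓ) …` in its STATEMENT (the V1 flat-cube port window, LF-1's root), so an `L = 3` T³ row exists only once an all-L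
member index does; it is then a ten-line copy of g1's §3 over this file.  Nothing here discharges N05∕N06, proves EX, the crux, V3∕R3, d = 4 or the mass gap.

References: T. Bałaban, CMP **99** (1985) 75–102 [Balaban1985RegularSpaces] (Prop. 6 (1.135)–(1.138) p.99, (1.33) p.82, p.98); CMP **99** (1985) 389–434
[Balaban1985BackgroundPropagators] ((3.35)–(3.36) p.396).
-/

set_option autoImplicit false

noncomputable section

open NormedSpace

namespace Summit.QuantumFields.YangMills.Theorems.Prop7SectET3ClassTransferZdL3

open Literature.MathematicalPhysics.QuantumFieldTheory.Balaban1983to89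
open B7Prop1Explicit B7Prop2Explicit B7Prop1Local
open B8Ineq132 (InAk)
open B8Eq133Hypotheses (shiftT byDir)
open B9Eq335RegularityClasses (Reg336Cube)
open LatticeNorms (scaleLen)
open B8Thm2TorusMember (torusIdx)
open B9SupplySockB9P3ZdFrame (IsCube396Zd)
open B8Prop6Reg335ZdAllTorus (exists_printCube_over_classCube)
open B8Prop6PrintedZdCubPGammaL3 (prop6Printed_zdCubP_γ_holds_L3)
open Node00 (CubeB8 GaugedBoundB8 zdCubP prop6Printed_zdCubP_iff)
open Summit.QuantumFields.YangMills.Theorems.Prop7SectET3ClassTransferZd (reg336Cube_of_gaugedBoundB8)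

variable {d : ℕ}

section OneCube

variable {𝔸 : Type} [CStarAlgebra 𝔸] [Nontrivial 𝔸]

/-- ★★ **[4] (3.35)–(3.36) ON A CLASS CUBE OF THE ALL-TORUS MEMBER, FROM [B8] PROPOSITION 6 — `d ≥ 2`, ODD `L ≥ 3`** (any nontrivial C⋆-algebra `𝔸`): the
`L ≥ 3` twin of ✓ `Prop7SectET3ClassTransferZd.reg336Cube_zd_of_inAk` (statement VERBATIM, `hL5` ↦ `hL3`).  There are `c35, c₆ > 0` (`c35 = 7dL³B₁ρ₀(11d + 21) + 1`,
`c₆ = c₁ ∕ (7dL³ρ₀(11d + 21))`, `B₁ = 5dLB₀`, with `ρ₀, B₀, c₁` the constants of `B8Prop6PrintedZdCubPGammaL3.prop6Printed_zdCubP_γ_holds_L3`) such that for every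
spacing `η > 0`, index `k ≥ 1`, block parameter `M ≥ 1`, every p. 396 class cube `Q` of index `k` (`IsCube396Zd M L k Q`), every unitary `U₀ ∈ 𝔄_k(ℤᵈ, α₀)` with
`M·α₀ ≤ c₆`, and every `C ≥ c35`: `Reg336Cube (shiftT d) (byDir U₀) η Q (Lᵏη) (C·M·α₀)`.  Proof = g1's: inscription of `Q` into a print cube of the auxiliary all-torus
datum `torusIdx ⟨η, k⟩` (`exists_printCube_over_classCube`), Proposition 6 there (odd `L ≥ 3` now), the per-cube bridge `reg336Cube_of_gaugedBoundB8`.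
[cite: Balaban1985RegularSpaces, Prop. 6 (1.135)–(1.138) p.99, (1.33) p.82, p.98; Balaban1985BackgroundPropagators, (3.35)–(3.36) p.396] -/
theorem reg336Cube_zd_of_inAk_L3 (hd2 : 2 ≤ d) {L : ℕ} (hL3 : 3 ≤ L) (hodd : Odd L) :
    ∃ c35 c₆ : ℝ, 0 < c35 ∧ 0 < c₆ ∧
      ∀ (η : ℝ) (_ : 0 < η) (k : ℕ) (_ : 1 ≤ k) (M : ℝ) (_ : 1 ≤ M) (Q : Set (B7Prop1Explicit.Site d)) (_ : IsCube396Zd M L k Q)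
        (U₀ : B7Prop1Explicit.Site d → Fin d → 𝔸ˣ) (_ : ∀ x κ, U₀ x κ ∈ unitaryUnits 𝔸) (α₀ : ℝ) (_ : 0 < α₀) (_ : M * α₀ ≤ c₆)
        (_ : InAk L k η α₀ (fun _ : ℕ => (Set.univ : Set (B7Prop1Explicit.Site d))) U₀) (C : ℝ) (_ : c35 ≤ C),
        Reg336Cube (shiftT d) (byDir U₀) η Q (scaleLen (L : ℝ) η k) (C * M * α₀) := by
  obtain ⟨ρ₀, B₀, c₁, hρ₀, hB₀, hc₁, H⟩ := prop6Printed_zdCubP_γ_holds_L3 (𝔸 := 𝔸) hd2 hL3 hodd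
  -- letters and positivity
  have hd1 : 1 ≤ d := le_trans one_le_two hd2
  have hL : 2 ≤ L := le_trans (by norm_num) hL3
  have hL1 : 1 ≤ L := le_trans one_le_two hL
  have hdR : (1 : ℝ) ≤ d := by exact_mod_cast hd1
  have hLR : (2 : ℝ) ≤ L := by exact_mod_cast hL
  have hρR : (1 : ℝ) ≤ ρ₀ := by exact_mod_cast hρ₀
  have hd0 : (0 : ℝ) < d := by linarith
  have hL0 : (0 : ℝ) < L := by linarith
  have hρ0 : (0 : ℝ) < ρ₀ := by linarith
  have hB₀0 : (0 : ℝ) ≤ B₀ := le_trans zero_le_one hB₀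
  set B₁ : ℝ := 5 * d * L * B₀ with hB₁
  have hB₁0 : 0 ≤ B₁ := by positivity
  refine ⟨7 * d * (L : ℝ) ^ 3 * B₁ * ρ₀ * (11 * d + 21) + 1, c₁ / (7 * d * (L : ℝ) ^ 3 * ρ₀ * (11 * d + 21)), by positivity, by positivity, ?_⟩
  intro η hη k hk M hM Q hQ U₀ hU₀ α₀ hα₀ hMα hIn C hC
  have hM0 : 0 ≤ M := le_trans zero_le_one hM
  have hceil : (⌈M⌉₊ : ℝ) ≤ 2 * M := by
    have := Nat.ceil_lt_add_one hM0
    linarith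
  -- inscription into a print cube of the all-torus datum `torusIdx ⟨η, k⟩` (truncation `m = k`)
  obtain ⟨c, hcP, hck, hQc, hcM⟩ := exists_printCube_over_classCube hd1 hL1 hρ₀ (j := k) (m := k) hk le_rfl hQ
  -- Proposition 6 at the cube (threshold from `Mα₀ ≤ c₆`)
  have hP := (prop6Printed_zdCubP_iff (𝔸 := 𝔸) (fun _ : Unit => torusIdx (d := d) hL1 ⟨η, hη, k, hk⟩) ρ₀ B₁ c₁).1 (H _) () α₀ hα₀ ⟨U₀, hU₀⟩ hIn c hcP
  have hcMR : (c.M : ℝ) ≤ ρ₀ * L * (11 * d + 21) * M := by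
    have h1 : (c.M : ℝ) ≤ ρ₀ * L * (10 * ⌈M⌉₊ + 11 * d + 1) := by exact_mod_cast hcM
    have h2 : (10 * ⌈M⌉₊ + 11 * d + 1 : ℝ) ≤ (11 * d + 21) * M := by
      nlinarith [mul_nonneg (sub_nonneg.2 hdR) (sub_nonneg.2 hM), hceil]
    have h3 : (ρ₀ : ℝ) * L * (10 * ⌈M⌉₊ + 11 * d + 1) ≤ ρ₀ * L * ((11 * d + 21) * M) := mul_le_mul_of_nonneg_left h2 (by positivity)
    linarith
  have hthr : 7 * d * (L : ℝ) ^ 2 * c.M * α₀ ≤ c₁ := by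
    have h1 : 7 * d * (L : ℝ) ^ 2 * c.M * α₀ ≤ 7 * d * (L : ℝ) ^ 2 * (ρ₀ * L * (11 * d + 21) * M) * α₀ := by
      apply mul_le_mul_of_nonneg_right _ hα₀.le
      exact mul_le_mul_of_nonneg_left hcMR (by positivity)
    have h2 : 7 * d * (L : ℝ) ^ 2 * (ρ₀ * L * (11 * d + 21) * M) * α₀ = 7 * d * (L : ℝ) ^ 3 * ρ₀ * (11 * d + 21) * (M * α₀) := by ring
    have hpos : 0 < 7 * d * (L : ℝ) ^ 3 * ρ₀ * (11 * d + 21) := by positivity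
    have h3 : 7 * d * (L : ℝ) ^ 3 * ρ₀ * (11 * d + 21) * (M * α₀) ≤ c₁ :=
      calc 7 * d * (L : ℝ) ^ 3 * ρ₀ * (11 * d + 21) * (M * α₀)
          ≤ 7 * d * (L : ℝ) ^ 3 * ρ₀ * (11 * d + 21) * (c₁ / (7 * d * (L : ℝ) ^ 3 * ρ₀ * (11 * d + 21))) :=
            mul_le_mul_of_nonneg_left hMα hpos.le
        _ = c₁ := by field_simp
    linarith
  have hG : GaugedBoundB8 L η U₀ c (7 * d * (L : ℝ) ^ 2 * B₁ * c.M * α₀) := hP hthr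
  -- the bridge §2, with `0 ≤ r = 7dL²B₁·c.M·α₀ < C·M·α₀`
  have hr : 0 ≤ 7 * d * (L : ℝ) ^ 2 * B₁ * c.M * α₀ := by positivity
  have hrC : 7 * d * (L : ℝ) ^ 2 * B₁ * c.M * α₀ < C * M * α₀ := by
    have h1 : 7 * d * (L : ℝ) ^ 2 * B₁ * c.M * α₀ ≤ 7 * d * (L : ℝ) ^ 3 * B₁ * ρ₀ * (11 * d + 21) * M * α₀ := by
      have : 7 * d * (L : ℝ) ^ 2 * B₁ * c.M * α₀ ≤ 7 * d * (L : ℝ) ^ 2 * B₁ * (ρ₀ * L * (11 * d + 21) * M) * α₀ := by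
        apply mul_le_mul_of_nonneg_right _ hα₀.le
        exact mul_le_mul_of_nonneg_left hcMR (by positivity)
      linarith [this]
    have hMα0 : 0 < M * α₀ := mul_pos (lt_of_lt_of_le one_pos hM) hα₀
    have h2 : (7 * d * (L : ℝ) ^ 3 * B₁ * ρ₀ * (11 * d + 21) + 1) * (M * α₀) ≤ C * (M * α₀) := mul_le_mul_of_nonneg_right hC hMα0.le
    nlinarith
  have hres := reg336Cube_of_gaugedBoundB8 hd2 hL hη c hr hrC hG hQc
  rw [hck] at hres
  exact hres

end OneCube

end Summit.QuantumFields.YangMills.Theorems.Prop7SectET3ClassTransferZdL3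

end
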